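import Mathlib
import Literature.Computability.AlgebraicComplexity.FSV18SuccinctGenerators
import HarnessLib

/-!
# FSV Def. 45 occur-`k` formulas: finite-family views of the gates and the occurrence count of a
# child's variables (model bridge for [ASSS16] §4 Lemmas 4.1/4.2) — proofs only

FSV 2018 Def. 45 (= ToC Def. 5.21) is the tree's mutual inductive `OccurFormula` / `OccurArgs` /
`OccurPowArgs` (`FSV18SuccinctGenerators.lean`) with `eval`, `size`, `depth`, `occur`. The proofs of
[ASSS16] §4 (arXiv:1111.0582) speak of a gate `G = H_1 + ⋯ + H_m` or `G = H_1^{e_1} ⋯ H_m^{e_m}`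
with an indexed family of children and count "at most `k · |∪ var(S_i)|` of its children depend on
the variables present in `∪ var(S_i)`" (Lemma 4.1, proof, p0018:L53–L60) from "`G` is a gate in an
occur-`k` formula". This file supplies exactly that bridge, with no new definitions:

* `OccurArgs.exists_fin_view`, `OccurPowArgs.exists_fin_view` — every argument list is an indexed
  family `φ : Fin m → OccurFormula` (and exponents `e : Fin m → ℕ`): `evalSum = Σ_i (φ i).eval`,
  `evalProd = ∏_i (φ i).eval ^ e i`, `occur j = Σ_i (φ i).occur j`, `size = Σ_i ((e i) + (φ i).size)`,
  `(φ i).depth ≤ depth` — the shape consumed by `ASSS16.iterPderiv_prod_pow_eq_mul_filter` /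
  `ASSS16.iterPderiv_sum_eq_sum_filter` (`ASSS16DerivativeAlgebra.lean`).
* `OccurFormula.one_le_occur_of_mem_vars` (with the `OccurArgs`/`OccurPowArgs` companions) — a
  variable of the computed polynomial occurs in some leaf below: `i ∈ vars(φ.eval) ⇒ 1 ≤ φ.occur i`.
* `card_filter_mem_vars_le_sum_occur` — hence the number of children whose polynomial involves `x_i`
  is at most `Σ_j (φ j).occur i`, i.e. at most the gate's `occur i ≤ k`: the hypothesis of
  `ASSS16.card_filter_dependsOn_le`.

Honest framing: syntax bookkeeping for the N1 occur push (FSV Thm. 48 / Cor. 49 bypass); nothing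
here bears on `VP ≠ VNP`.

## References
* [ForbesShpilkaVolk2018] Def. 45 (seq.) = ToC Def. 5.21 (locator: paper:arxiv-1701.05328
  p0020.txt:L65).
* [AgrawalEtAl2011] Lemma 4.1 proof, §7.3 (locator: paper:arxiv-1111.0582 p0018.txt:L53–L60).
-/

noncomputable section

namespace Literature.Computability.AlgebraicComplexity

open MvPolynomial Finset

open scoped BigOperators

variable {F : Type*} [Field F] {ι : Type*}

/-! ### Argument lists as indexed families -/

/-- **A `+` gate is `H_1 + ⋯ + H_m` for an indexed family of children** (Def. 45's argument list
read as `φ : Fin m → OccurFormula`), with the additive bookkeeping of `occur` and `size` and the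
`max` bookkeeping of `depth`. [cite: ForbesShpilkaVolk2018, Def. 45 (seq.) = ToC Def. 5.21; AgrawalEtAl2011, Lemma 4.1 proof ("Suppose `G = H_1 + ⋯ + H_m`")]
locator: paper:arxiv-1701.05328 p0020.txt:L65; paper:arxiv-1111.0582 p0018.txt:L53 -/
theorem OccurArgs.exists_fin_view : ∀ as : OccurArgs F ι,
    ∃ (m : ℕ) (φ : Fin m → OccurFormula F ι),
      as.evalSum = ∑ i, (φ i).eval ∧ (∀ j, as.occur j = ∑ i, (φ i).occur j) ∧
        as.size = ∑ i, (φ i).size ∧ ∀ i, (φ i).depth ≤ as.depth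
  | .nil => ⟨0, Fin.elim0, by rw [OccurArgs.evalSum, Fintype.sum_empty],
      fun j => by rw [OccurArgs.occur, Fintype.sum_empty],
      by rw [OccurArgs.size, Fintype.sum_empty], fun i => i.elim0⟩
  | .cons ψ rest => by
    obtain ⟨m, φ, hev, hocc, hsz, hdp⟩ := OccurArgs.exists_fin_view rest
    refine ⟨m + 1, Fin.cons ψ φ, ?_, fun j => ?_, ?_, fun i => ?_⟩
    · rw [OccurArgs.evalSum, hev, Fin.sum_univ_succ, Fin.cons_zero]
      simp only [Fin.cons_succ]
    · rw [OccurArgs.occur, hocc, Fin.sum_univ_succ, Fin.cons_zero]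
      simp only [Fin.cons_succ]
    · rw [OccurArgs.size, hsz, Fin.sum_univ_succ, Fin.cons_zero]
      simp only [Fin.cons_succ]
    · rw [OccurArgs.depth]
      refine Fin.cases ?_ (fun i => ?_) i
      · rw [Fin.cons_zero]; exact le_max_left _ _
      · rw [Fin.cons_succ]; exact (hdp i).trans (le_max_right _ _)

/-- **A `×∧` gate is `H_1^{e_1} ⋯ H_m^{e_m}` for an indexed family of children and exponent labels**,
with `occur` additive, `size = Σ (e_i + size H_i)`, `depth H_i ≤ depth`.
[cite: ForbesShpilkaVolk2018, Def. 45 (seq.) = ToC Def. 5.21; AgrawalEtAl2011, Lemma 4.1 proof ("Suppose `G = H_1^{e_1} ⋯ H_m^{e_m}`")]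
locator: paper:arxiv-1701.05328 p0020.txt:L65; paper:arxiv-1111.0582 p0018.txt:L58 -/
theorem OccurPowArgs.exists_fin_view : ∀ ps : OccurPowArgs F ι,
    ∃ (m : ℕ) (φ : Fin m → OccurFormula F ι) (e : Fin m → ℕ),
      ps.evalProd = ∏ i, (φ i).eval ^ e i ∧ (∀ j, ps.occur j = ∑ i, (φ i).occur j) ∧
        ps.size = ∑ i, (e i + (φ i).size) ∧ ∀ i, (φ i).depth ≤ ps.depth
  | .nil => ⟨0, Fin.elim0, Fin.elim0, by rw [OccurPowArgs.evalProd, Fintype.prod_empty],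
      fun j => by rw [OccurPowArgs.occur, Fintype.sum_empty],
      by rw [OccurPowArgs.size, Fintype.sum_empty], fun i => i.elim0⟩
  | .cons ψ e₀ rest => by
    obtain ⟨m, φ, e, hev, hocc, hsz, hdp⟩ := OccurPowArgs.exists_fin_view rest
    refine ⟨m + 1, Fin.cons ψ φ, Fin.cons e₀ e, ?_, fun j => ?_, ?_, fun i => ?_⟩
    · rw [OccurPowArgs.evalProd, hev, Fin.prod_univ_succ, Fin.cons_zero, Fin.cons_zero]
      simp only [Fin.cons_succ]
    · rw [OccurPowArgs.occur, hocc, Fin.sum_univ_succ, Fin.cons_zero]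
      simp only [Fin.cons_succ]
    · rw [OccurPowArgs.size, hsz, Fin.sum_univ_succ, Fin.cons_zero, Fin.cons_zero]
      simp only [Fin.cons_succ]
    · rw [OccurPowArgs.depth]
      refine Fin.cases ?_ (fun i => ?_) i
      · rw [Fin.cons_zero]; exact le_max_left _ _
      · rw [Fin.cons_succ]; exact (hdp i).trans (le_max_right _ _)

/-! ### A variable of the computed polynomial occurs in a leaf below -/

mutual
/-- **`i ∈ vars(φ.eval) ⇒ x_i` occurs in at least one leaf of `φ`** (Def. 45: `occur i` counts the
leaves whose sparse polynomial involves `x_i`; the polynomial of a gate only involves variables of its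
leaves) — the model form of "the other gates are independent of the variables in `∪ S_i`".
[cite: ForbesShpilkaVolk2018, Def. 45 (seq.) = ToC Def. 5.21; AgrawalEtAl2011, Lemma 4.1 proof]
locator: paper:arxiv-1701.05328 p0020.txt:L65; paper:arxiv-1111.0582 p0018.txt:L54–L60 -/
theorem OccurFormula.one_le_occur_of_mem_vars [DecidableEq ι] (i : ι) : ∀ φ : OccurFormula F ι,
    i ∈ φ.eval.vars → 1 ≤ φ.occur i
  | .leaf p => fun h => by
    rw [OccurFormula.eval] at h
    rw [OccurFormula.occur, if_neg (mem_vars_iff_degreeOf_ne_zero.mp h)]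
  | .add as => fun h => by
    rw [OccurFormula.eval] at h
    rw [OccurFormula.occur]
    exact OccurArgs.one_le_occur_of_mem_vars i as h
  | .powProd ps => fun h => by
    rw [OccurFormula.eval] at h
    rw [OccurFormula.occur]
    exact OccurPowArgs.one_le_occur_of_mem_vars i ps h

/-- `+` argument lists: a variable of the sum occurs below. [cite: ForbesShpilkaVolk2018, Def. 45 (seq.) = ToC Def. 5.21] -/
theorem OccurArgs.one_le_occur_of_mem_vars [DecidableEq ι] (i : ι) : ∀ as : OccurArgs F ι,
    i ∈ as.evalSum.vars → 1 ≤ as.occur i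
  | .nil => fun h => by
    rw [OccurArgs.evalSum, vars_0] at h
    exact absurd h (Finset.notMem_empty _)
  | .cons φ rest => fun h => by
    rw [OccurArgs.evalSum] at h
    rw [OccurArgs.occur]
    rcases Finset.mem_union.mp (vars_add_subset _ _ h) with h | h
    · exact (OccurFormula.one_le_occur_of_mem_vars i φ h).trans (Nat.le_add_right _ _)
    · exact (OccurArgs.one_le_occur_of_mem_vars i rest h).trans (Nat.le_add_left _ _)

/-- `×∧` argument lists: a variable of the power product occurs below.
[cite: ForbesShpilkaVolk2018, Def. 45 (seq.) = ToC Def. 5.21] -/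
theorem OccurPowArgs.one_le_occur_of_mem_vars [DecidableEq ι] (i : ι) : ∀ ps : OccurPowArgs F ι,
    i ∈ ps.evalProd.vars → 1 ≤ ps.occur i
  | .nil => fun h => by
    rw [OccurPowArgs.evalProd, vars_one] at h
    exact absurd h (Finset.notMem_empty _)
  | .cons φ e rest => fun h => by
    rw [OccurPowArgs.evalProd] at h
    rw [OccurPowArgs.occur]
    rcases Finset.mem_union.mp (vars_mul _ _ h) with h | h
    · exact (OccurFormula.one_le_occur_of_mem_vars i φ (vars_pow _ _ h)).trans
        (Nat.le_add_right _ _)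
    · exact (OccurPowArgs.one_le_occur_of_mem_vars i rest h).trans (Nat.le_add_left _ _)
end

/-- **The occur-`k` count of Lemma 4.1 in the model:** among an indexed family of sub-formulas, the
number whose polynomial involves `x_i` is at most `Σ_j occur i (φ j)` (so at most `k` for the
children of a gate of an occur-`k` formula: "at most `k·|∪ var(S_i)|` of the `H_i`'s depend on the
variables in `∪ S_i`"). [cite: AgrawalEtAl2011, Lemma 4.1 (= lem:derivative-content), proof]
locator: paper:arxiv-1111.0582 p0018.txt:L54–L60 -/
theorem card_filter_mem_vars_le_sum_occur [DecidableEq ι] {m : ℕ} (φ : Fin m → OccurFormula F ι)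
    (i : ι) : (Finset.univ.filter fun j => i ∈ (φ j).eval.vars).card ≤ ∑ j, (φ j).occur i := by
  rw [Finset.card_eq_sum_ones, Finset.sum_filter]
  refine Finset.sum_le_sum fun j _ => ?_
  split_ifs with h
  · exact OccurFormula.one_le_occur_of_mem_vars i (φ j) h
  · exact Nat.zero_le _

/-- Packaged for a `+` gate of an occur-`k` formula: its children `φ` (from `exists_fin_view`)
satisfy the hypothesis of `ASSS16.card_filter_dependsOn_le`.
[cite: AgrawalEtAl2011, Lemma 4.1 (= lem:derivative-content), first bullet] locator: paper:arxiv-1111.0582 p0018.txt:L53–L56 -/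
theorem OccurArgs.card_filter_mem_vars_le [DecidableEq ι] {m k : ℕ} (as : OccurArgs F ι)
    (φ : Fin m → OccurFormula F ι) (hocc : ∀ j, as.occur j = ∑ i, (φ i).occur j)
    (hk : ∀ i, (OccurFormula.add as).occur i ≤ k) (i : ι) :
    (Finset.univ.filter fun j => i ∈ (φ j).eval.vars).card ≤ k := by
  refine (card_filter_mem_vars_le_sum_occur φ i).trans ?_
  rw [← hocc]
  have h := hk i
  rw [OccurFormula.occur] at h
  exact h

/-- Packaged for a `×∧` gate of an occur-`k` formula. [cite: AgrawalEtAl2011, Lemma 4.1 (= lem:derivative-content), second bullet]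
locator: paper:arxiv-1111.0582 p0018.txt:L58–L60 -/
theorem OccurPowArgs.card_filter_mem_vars_le [DecidableEq ι] {m k : ℕ} (ps : OccurPowArgs F ι)
    (φ : Fin m → OccurFormula F ι) (hocc : ∀ j, ps.occur j = ∑ i, (φ i).occur j)
    (hk : ∀ i, (OccurFormula.powProd ps).occur i ≤ k) (i : ι) :
    (Finset.univ.filter fun j => i ∈ (φ j).eval.vars).card ≤ k := by
  refine (card_filter_mem_vars_le_sum_occur φ i).trans ?_
  rw [← hocc]
  have h := hk i
  rw [OccurFormula.occur] at h
  exact h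

end Literature.Computability.AlgebraicComplexity
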